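import Summits.Ventures.CertifiedManyBodySolver.Theorems.M3x2EdgeSplitSymReplayGramRShards
import Summits.Ventures.CertifiedManyBodySolver.Theorems.M3x2EdgeSplitSymReplayShardsD
import HarnessLib

/-!
# SymReplay gramR — FAST per-call accessors for R-shards and per-block side conditions (R × T12c/d; module 1/2 of `GramRShardsFast`)
(pen hub-lb-sym-plan-1 g2, 2026-08-28, rev 2 = crux workfile `Cruxes/LowerEdge_ge_m83o100/GramRShardsFast_symplan1.lean`
8a70004e41b9, sha16 b4aa7cc53e8357bb, §(a)–(e) byte-identical; landed by the one writer hub-lb-sym-eng-3, split in two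
modules for the 400-line bar — §(f)–(g), the LOCAL base under the R-blocks, is `…GramRShardsLocal`.  ADDITIVE on the landed
`…GramRShards` (p631300) and `…ShardsC/…ShardsD`; nothing of them is touched; one-writer rule.)

WHY.  `shardPolyAtR K c j` of `…GramRShards` indexes `shardPolysR K c`, whose compiled evaluation is STRICT — one farm call
would materialise EVERY shard (T12c found the same for `shardPolyAt`); and `hRok : K.gramR.all (gramBlockROK K.frame)` is ONE
call over all R-blocks (≈ 8 s per D₄ block of the `mm.c0/22` size on the farm ⇒ ≈ 85 × 8 s on v0′, above the 300-s cap).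
CONTENTS (all `_eq`-certified against the landed definitions, soundness untouched):
* `blockChunksR / blockShardAtR / shardsFromR` — walk the R-blocks by chunk COUNTS, expand only the target chunk;
  `shardPolyAtRFast K c j` (base part through T12c's `shardPolyAtFast K.toSymCert c j`, R part through `shardsFromR`) with
  `shardPolyAtRFast_eq : … = shardPolyAtR K c j`; `shardCountR K c` with `shardCountR_eq : … = (shardPolysR K c).length`;
* `shardOKRFast` / `ShardFactsRFast` (T1 canonicaliser) and the EXECUTED `shardOKRFastV` / `ShardFactsRFastV` (T12d's `canonNFV`);
* `gramROKAt K i` (side conditions of R-block `i` ALONE) and the structural `GramROKFacts K i n` with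
  `gramR_all_of_facts : K.gramR.length = n → GramROKFacts K 0 n → K.gramR.all (gramBlockROK K.frame) = true`;
* closing theorems `wardD4CertGe_of_shardsRFastV` / `energyDensity_ge_of_shardsRFastV` (T12b base); kernel regressions on `toyRCert`.

MULTI-CALL CLOSING GRAMMAR of an R-literal `K := decodeSymCertR (toks certS) (toks gramRS)` (executed path, DENSE base; the
path of record with the LOCAL base is in `…GramRShardsLocal`): per shard `j < shardCountR K c` one theorem
`shard_j : shardOKRFastV K c j P_j = true := by native_decide`; per R-block `i` one theorem
`rok_i : gramROKAt K i = true := by native_decide` (several per module); then `hwf : wellFormed K.expand = true`, `hn :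
K.gramR.length = n`, `hcount : shardCountR K c = m + 1` (cheap calls), `hRok := gramR_all_of_facts K n hn ⟨rok_0, …, rok_{n−1}, trivial⟩`,
`hfacts : ShardFactsRFastV K c 0 [P₀,…,P_m] := ⟨shard_0, …, shard_m, trivial⟩`, `hfin : isZero (canonNFV K.frame [P₀,…].flatten) = true`
(one call), and `energyDensity_ge_of_shardsRFastV K hwf hRok c [P₀,…] hcount hfacts hfin` (or `nearCertWardSlack_of_wardD4CertGe
(wardD4CertGe_of_shardsRFastV …) (by norm_num)` for the registered `≥ −83/100` stub).

HONEST FRAMING: plumbing for a checker COST lever; no certificate beyond the toy is replayed; no bound of record moves; no summit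
or crux statement is proved here; nothing here predicts superconductivity.
-/

noncomputable section

namespace Summit.Ventures.CertifiedManyBodySolver.Theorems.SymReplay

open Matrix Finset
open Literature.MathematicalPhysics.QuantumLattice
open Literature.MathematicalPhysics.QuantumLattice.HubbardWave0
open Literature.MathematicalPhysics.QuantumLattice.ThermodynamicLimit
open Literature.Probability.LatticeModels
open Literature.MathematicalPhysics.QuantumManyBody.StateRelaxation
open Summit.Ventures.CertifiedManyBodySolver.Theorems.WardSlot
open scoped ComplexOrder BigOperators

/-! ##### (a) Fast R-shard accessor -/

/-- The row chunks of an R-block (spine only: representatives zipped with factor rows; no products). -/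
def blockChunksR (c : ℕ) (B : GramBlockR) : List (List (QPoly × List (ℚ × ℕ))) :=
  chunksOf c (B.reps.zip B.rows).length (B.reps.zip B.rows)

/-- Shard `i` of an R-block, if any: `−(|moves| · scale) •` the representative rows of its `i`-th chunk. -/
def blockShardAtR (c : ℕ) (B : GramBlockR) (i : ℕ) : Option QPoly :=
  ((blockChunksR c B)[i]?).map fun ch => pscale (-((B.moves.length : ℚ) * B.scale)) (blockRowsPolyR B ch)

/-- The fast R-block-shard accessor agrees with indexing `blockShardPolysR`. -/
theorem blockShardAtR_eq (c : ℕ) (B : GramBlockR) (i : ℕ) : blockShardAtR c B i = (blockShardPolysR c B)[i]? := by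
  rw [blockShardAtR, blockShardPolysR, List.getElem?_map]
  rfl

/-- An R-block has one shard per row chunk. -/
theorem length_blockShardPolysR (c : ℕ) (B : GramBlockR) :
    (blockShardPolysR c B).length = (blockChunksR c B).length := by
  rw [blockShardPolysR, List.length_map]
  rfl

/-- Shard `i` among the shards of an R-block list, by walking chunk COUNTS (only the target chunk is expanded). -/
def shardsFromR (c : ℕ) : List GramBlockR → ℕ → QPoly
  | [], _ => []
  | B :: rest, i =>
    if i < (blockChunksR c B).length then (blockShardAtR c B i).getD []
    else shardsFromR c rest (i - (blockChunksR c B).length)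

/-- Walking by chunk counts agrees with indexing the concatenated R-block shards. -/
theorem shardsFromR_eq (c : ℕ) : ∀ (Bs : List GramBlockR) (i : ℕ),
    shardsFromR c Bs i = ((Bs.flatMap (blockShardPolysR c))[i]?).getD []
  | [], i => by simp [shardsFromR]
  | B :: rest, i => by
    rw [shardsFromR, List.flatMap_cons]
    split_ifs with h
    · rw [List.getElem?_append_left (by rw [length_blockShardPolysR]; exact h), blockShardAtR_eq]
    · rw [List.getElem?_append_right (by rw [length_blockShardPolysR]; omega), length_blockShardPolysR,
        shardsFromR_eq c rest]

/-- **R-shard `j`, computed alone**: the base certificate's shards through T12c's fast accessor, then the R-blocks. -/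
def shardPolyAtRFast (K : SymCertR) (c j : ℕ) : QPoly :=
  if j < shardCount K.toSymCert c then shardPolyAtFast K.toSymCert c j
  else shardsFromR c K.gramR (j - shardCount K.toSymCert c)

/-- The fast accessor IS the `…GramRShards` accessor. -/
theorem shardPolyAtRFast_eq (K : SymCertR) (c j : ℕ) : shardPolyAtRFast K c j = shardPolyAtR K c j := by
  unfold shardPolyAtRFast shardPolyAtR shardPolysR
  split_ifs with h
  · rw [shardPolyAtFast_eq, shardPolyAt, List.getElem?_append_left (by rwa [← shardCount_eq])]
  · rw [List.getElem?_append_right (by rw [← shardCount_eq]; omega), ← shardCount_eq, shardsFromR_eq]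

/-- **The number of R-shards, computed without the shards.** -/
def shardCountR (K : SymCertR) (c : ℕ) : ℕ :=
  shardCount K.toSymCert c + (K.gramR.map fun B => (blockChunksR c B).length).sum

/-- The fast count IS the number of R-shards. -/
theorem shardCountR_eq (K : SymCertR) (c : ℕ) : shardCountR K c = (shardPolysR K c).length := by
  rw [shardCountR, shardPolysR, List.length_append, shardCount_eq, List.length_flatMap]
  congr 2
  exact List.map_congr_left fun B _ => (length_blockShardPolysR c B).symm

/-! ##### (b) Per-call facts, fast and executed forms -/

/-- **What ONE farm call proves about R-shard `j` — fast form** (only shard `j` is expanded; T1 canonicaliser). -/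
def shardOKRFast (K : SymCertR) (c j : ℕ) (P : QPoly) : Bool :=
  psuppIn P K.frame && isZero (psub (canonNF K.frame (shardPolyAtRFast K c j)) P)

/-- The fast per-call fact IS the `…GramRShards` per-call fact. -/
theorem shardOKRFast_eq (K : SymCertR) (c j : ℕ) (P : QPoly) : shardOKRFast K c j P = shardOKR K c j P := by
  rw [shardOKRFast, shardOKR, shardPolyAtRFast_eq]

/-- The per-call facts in fast form (structural on the literal partial list). -/
def ShardFactsRFast (K : SymCertR) (c : ℕ) : ℕ → List QPoly → Prop
  | _, [] => True
  | j, P :: Ps => shardOKRFast K c j P = true ∧ ShardFactsRFast K c (j + 1) Ps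

/-- Fast per-call facts give the `…GramRShards` facts. -/
theorem shardFactsR_of_fast (K : SymCertR) (c : ℕ) :
    ∀ (Ps : List QPoly) (j : ℕ), ShardFactsRFast K c j Ps → ShardFactsR K c j Ps
  | [], _, _ => trivial
  | P :: Ps, j, h => ⟨(shardOKRFast_eq K c j P) ▸ h.1, shardFactsR_of_fast K c Ps (j + 1) h.2⟩

/-- **Executed per-call fact**: the fast accessor through T12d's executed canonicaliser `canonNFV`. -/
def shardOKRFastV (K : SymCertR) (c j : ℕ) (P : QPoly) : Bool :=
  psuppIn P K.frame && isZero (psub (canonNFV K.frame (shardPolyAtRFast K c j)) P)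

/-- The executed per-call fact IS the fast per-call fact. -/
theorem shardOKRFastV_eq (K : SymCertR) (c j : ℕ) (P : QPoly) : shardOKRFastV K c j P = shardOKRFast K c j P := by
  rw [shardOKRFastV, shardOKRFast, canonNFV_eq]

/-- Executed per-call facts (structural). -/
def ShardFactsRFastV (K : SymCertR) (c : ℕ) : ℕ → List QPoly → Prop
  | _, [] => True
  | j, P :: Ps => shardOKRFastV K c j P = true ∧ ShardFactsRFastV K c (j + 1) Ps

/-- Executed facts give fast facts. -/
theorem shardFactsRFast_of_V (K : SymCertR) (c : ℕ) :
    ∀ (Ps : List QPoly) (j : ℕ), ShardFactsRFastV K c j Ps → ShardFactsRFast K c j Ps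
  | [], _, _ => trivial
  | P :: Ps, j, h => ⟨(shardOKRFastV_eq K c j P) ▸ h.1, shardFactsRFast_of_V K c Ps (j + 1) h.2⟩

/-! ##### (c) Per-block side conditions, one R-block per call -/

/-- **Side conditions of R-block `i` ALONE** (`true` past the end). -/
def gramROKAt (K : SymCertR) (i : ℕ) : Bool :=
  match K.gramR[i]? with
  | none => true
  | some B => gramBlockROK K.frame B

/-- The per-block facts `gramROKAt K i = true` for `i, i+1, …, i+n−1` (structural on the count `n`). -/
def GramROKFacts (K : SymCertR) : ℕ → ℕ → Prop
  | _, 0 => True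
  | i, n + 1 => gramROKAt K i = true ∧ GramROKFacts K (i + 1) n

/-- Helper: per-index facts on a suffix give `List.all` on that suffix. -/
theorem all_drop_of_gramROKFacts (K : SymCertR) :
    ∀ (n i : ℕ), i + n = K.gramR.length → GramROKFacts K i n → (K.gramR.drop i).all (gramBlockROK K.frame) = true
  | 0, i, hi, _ => by
    rw [List.drop_eq_nil_of_le (by omega)]
    rfl
  | n + 1, i, hi, h => by
    have hlt : i < K.gramR.length := by omega
    rw [List.drop_eq_getElem_cons hlt, List.all_cons, all_drop_of_gramROKFacts K n (i + 1) (by omega) h.2, Bool.and_true]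
    have h1 := h.1
    rw [gramROKAt, List.getElem?_eq_getElem hlt] at h1
    exact h1

/-- **All R-block side conditions from the per-block facts.** -/
theorem gramR_all_of_facts (K : SymCertR) (n : ℕ) (hn : K.gramR.length = n) (h : GramROKFacts K 0 n) :
    K.gramR.all (gramBlockROK K.frame) = true := by
  have := all_drop_of_gramROKFacts K n 0 (by omega) h
  rwa [List.drop_zero] at this

/-! ##### (d) Closing theorems -/

/-- **SHARDED R-REPLAY, FAST EXECUTED CLOSING FORM** (see the module docstring for the grammar). -/
theorem wardD4CertGe_of_shardsRFastV (K : SymCertR) (hwf : wellFormed K.expand = true)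
    (hRok : K.gramR.all (gramBlockROK K.frame) = true) (c : ℕ) (Ps : List QPoly)
    (hcount : shardCountR K c = Ps.length) (hfacts : ShardFactsRFastV K c 0 Ps)
    (hfin : isZero (canonNFV K.frame Ps.flatten) = true) : WardD4CertGe ((symValueR K : ℚ) : ℝ) :=
  wardD4CertGe_of_shardsR K hwf hRok c Ps ((shardCountR_eq K c).symm.trans hcount)
    (shardFactsR_of_fast K c Ps 0 (shardFactsRFast_of_V K c Ps 0 hfacts)) (isZero_canonNF_of_V _ _ hfin)

/-- … and the energy-density bound. -/
theorem energyDensity_ge_of_shardsRFastV (K : SymCertR) (hwf : wellFormed K.expand = true)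
    (hRok : K.gramR.all (gramBlockROK K.frame) = true) (c : ℕ) (Ps : List QPoly)
    (hcount : shardCountR K c = Ps.length) (hfacts : ShardFactsRFastV K c 0 Ps)
    (hfin : isZero (canonNFV K.frame Ps.flatten) = true) :
    ((symValueR K : ℚ) : ℝ) ≤ energyDensityTT' 1 0 8 (7 / 8) :=
  energyDensity_ge_of_windowSound_cert _ WardSlot.stub_wardWindowSound
    (wardD4CertGe_of_shardsRFastV K hwf hRok c Ps hcount hfacts hfin)

/-! ##### (e) Kernel regressions on `toyRCert` (3 R-shards at `c = 0`: base + one chunk per R-block; 2 R-blocks) -/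

/-- The fast count and the fast accessor agree with `…GramRShards` on the toy. -/
example : shardCountR toyRCert 0 = 3 ∧
    (isZero (psub (shardPolyAtRFast toyRCert 0 1) (shardPolyAtR toyRCert 0 1)) &&
      isZero (psub (shardPolyAtRFast toyRCert 0 2) (shardPolyAtR toyRCert 0 2))) = true := by decide +kernel

/-- The per-block side conditions, one block per fact, reassemble to `hRok`. -/
example : toyRCert.gramR.all (gramBlockROK toyRCert.frame) = true :=
  gramR_all_of_facts toyRCert 2 (by decide +kernel) ⟨by decide +kernel, by decide +kernel, trivial⟩

/-- Non-vacuity: a wrong per-block index range does not close (`GramROKFacts` with a short count proves less). -/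
example : gramROKAt toyRCert 0 = true ∧ gramROKAt toyRCert 5 = true := by decide +kernel

end Summit.Ventures.CertifiedManyBodySolver.Theorems.SymReplay
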